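import Mathlib
import Summits.ValiantsHypothesis.ValiantsHypothesis.Theorems.NewtonUnitEquationsDissociatedUniformTotalsLaw
import Summits.ValiantsHypothesis.ValiantsHypothesis.Theorems.NewtonUnitEquationsDissociatedUniformTotalsLawShares
import Summits.ValiantsHypothesis.ValiantsHypothesis.Theorems.NewtonUnitEquationsDissociatedUniformTotalsLawChartTops
import Summits.ValiantsHypothesis.ValiantsHypothesis.Theorems.NewtonUnitEquationsDissociatedUniformTotalsLawSweep
import Summits.ValiantsHypothesis.ValiantsHypothesis.Theorems.NewtonUnitEquationsDissociatedUniformTotalsLawChartMargins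
import Literature.Computability.AlgebraicComplexity.NewtonPolygonTauProductBounds
import HarnessLib

/-!
# Crux `NewtonUnitEquations.DissociatedUniform` (stmt-ValiantsHypothesis-5905): totals law — the LARGE-THIRD-CURVE (separated) regime is a kernel theorem

Memo `Cruxes/DissociatedUniform/NOTES-d1g3.md` §2 L5 names two provable regimes of the `n = 3` totals law of model (Q**); the
small-third-curve end is `…TotalsLawSmallThird`.  This file proves the other end ("third curve dominant", start packet
`Cruxes/DissociatedUniform/NOTES-t1.md` D7/§5(i)): for curves `a, b` and an INJECTIVE third curve `c` there is `μ₀` such that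
`T(a, b, μ • c) ≤ V_P + 2|G| + 14|G|² (≤ 17|G|²)` for all `μ ≥ μ₀` (`totalVert_smul_le_of_large`,
`totalVert_smul_le_seventeen_mul_sq`; `V_P = fibreTotal a b`).  No general position is assumed.  Proof = the abstract sweep `…TotalsLawSweep.sum_card_chartTops_class_le` along each half-chart `σ = ±1` with the following
localisation data (`sum_card_chartTops_smul_le`, extra `7|G|²` per chart):
* CORES `Y z = {t : c z is the strict top of C at time t}` (time-ordered);
* WINDOWS `(u - ε, u + ε)` around the tie times `u` of `C` that carry `≥ 2` maximising positions (allowed set = the maximisers,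
  `≤ 2|G|` in total by `sum_card_maxSet_le`; each window sees `≤ 2` tops of every fibre since `2ε` is below the separation of all
  tie times), and two END WINDOWS `t > T`, `t < -T` (allowed = positions of extreme second coordinate; `≤ 1` fibre top each);
* COVER for `μ ≥ μ₀`: an exposed word at position `z` satisfies the winning-position inequality
  `μ (⟨w, c z'⟩ - ⟨w, c z⟩) ≤ bandWidth ≤ (1 + |t|) R` (`qual_of_isStrictTop`, `bandWidth_le`), which the margins of
  `…TotalsLawChartMargins` (`far_margin`, `near_margin`/`isStrictTop_near`, `end_margin_top/_bot`) turn into "`t ∈ Y z` or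
  `(t, z)` lies in a window" once `μ κ`, `μ g / 2`, `μ κ₁ / 2` beat `(1 + T) R`, `(1 + T) R`, `2R`.
Honest label: a regime theorem with a crude constant (the memo's value at this end is `V_P + q · vert(C) ≤ 2q²`); the totals law
`TotalsLawThree C` itself stays OPEN; nothing here bears on `VP ≠ VNP`.
[folklore]
-/

set_option linter.dupNamespace false -- `ValiantsHypothesis.ValiantsHypothesis` (summit = problem) in every name

open scoped BigOperators
open Matrix Finset

namespace Summit.ValiantsHypothesis.ValiantsHypothesis.Theorems.NewtonUnitEquationsDissociatedUniform

namespace TotalsLaw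

open Literature.Computability.AlgebraicComplexity.KPTT.PlanarMinkowski

variable {G : Type*} [AddCommGroup G] [Fintype G]

/-! ### Small tools -/

omit [AddCommGroup G] in
open Classical in
/-- Scaling the curve by `μ > 0` keeps strict tops. [folklore] -/
theorem isStrictTop_image_smul {w : Fin 2 → ℝ} {c : G → (Fin 2 → ℝ)} {z : G} {μ : ℝ} (hμ : 0 < μ)
    (h : IsStrictTop w (Finset.univ.image c) (c z)) :
    IsStrictTop w (Finset.univ.image (μ • c)) ((μ • c) z) := by
  refine ⟨Finset.mem_image.2 ⟨z, Finset.mem_univ _, rfl⟩, fun y hy hne => ?_⟩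
  obtain ⟨z', -, rfl⟩ := Finset.mem_image.1 hy
  have hne' : c z' ≠ c z := fun heq => hne (by rw [Pi.smul_apply, Pi.smul_apply, heq])
  have := h.lt (Finset.mem_image.2 ⟨z', Finset.mem_univ _, rfl⟩) hne'
  rw [Pi.smul_apply, Pi.smul_apply, dotProduct_smul, dotProduct_smul, smul_eq_mul, smul_eq_mul]
  exact mul_lt_mul_of_pos_left this hμ

omit [AddCommGroup G] in
/-- Coordinates of the third curve differ by at most `Λ = 2 ∑_z (|c z 0| + |c z 1|)`. [folklore] -/
theorem abs_coord_sub_le (c : G → (Fin 2 → ℝ)) (z z' : G) (i : Fin 2) :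
    |c z i - c z' i| ≤ 2 * ∑ u, (|c u 0| + |c u 1|) := by
  have h1 : ∀ v : G, |c v i| ≤ ∑ u, (|c u 0| + |c u 1|) := fun v => le_trans (by fin_cases i <;> simp)
    (Finset.single_le_sum (f := fun u => |c u 0| + |c u 1|) (fun u _ => by positivity) (Finset.mem_univ v))
  exact (abs_sub _ _).trans (by linarith [h1 z, h1 z'])

open Classical in
/-- A window `(u - ε, u + ε)` with `2ε` below the separation of the tie times of `P` sees at most two tops of `P`. [folklore] -/
theorem card_chartTops_window_le_two (σ : ℝ) (P : Finset (Fin 2 → ℝ)) (u ε γ : ℝ)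
    (hγ : ∀ τ ∈ tieTimes σ P, ∀ τ' ∈ tieTimes σ P, τ ≠ τ' → γ ≤ |τ - τ'|) (hε : 2 * ε ≤ γ) :
    (P.filter fun p => ∃ t ∈ Set.Ioo (u - ε) (u + ε), IsStrictTop ![σ, t] P p).card ≤ 2 := by
  classical
  refine (card_chartTops_le_card_ties_add_one σ P (Set.Ioo (u - ε) (u + ε)) Set.ordConnected_Ioo).trans ?_
  refine Nat.add_le_add_right (Finset.card_le_one.2 fun τ hτ τ' hτ' => ?_) 1
  by_contra hne
  simp only [Finset.mem_filter] at hτ hτ'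
  obtain ⟨hτT, hτI⟩ := hτ
  obtain ⟨hτ'T, hτ'I⟩ := hτ'
  have h := hγ τ hτT τ' hτ'T hne
  have hlt : |τ - τ'| < 2 * ε := by rw [abs_sub_lt_iff]; constructor <;> linarith [hτI.1, hτI.2, hτ'I.1, hτ'I.2]
  linarith

open Classical in
/-- Beyond all tie times of `P` (to the right) at most one top of `P` appears. [folklore] -/
theorem card_chartTops_Ioi_le_one (σ : ℝ) (P : Finset (Fin 2 → ℝ)) (T : ℝ) (hT : ∀ τ ∈ tieTimes σ P, τ ≤ T) :
    (P.filter fun p => ∃ t ∈ Set.Ioi T, IsStrictTop ![σ, t] P p).card ≤ 1 := by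
  classical
  refine (card_chartTops_le_card_ties_add_one σ P (Set.Ioi T) Set.ordConnected_Ioi).trans ?_
  exact Nat.add_le_add_right (Nat.le_zero.2 (Finset.card_eq_zero.2 (Finset.filter_eq_empty_iff.2
    fun τ hτ hτI => absurd (hT τ hτ) (not_le.2 hτI)))) 1

open Classical in
/-- Beyond all tie times of `P` (to the left) at most one top of `P` appears. [folklore] -/
theorem card_chartTops_Iio_le_one (σ : ℝ) (P : Finset (Fin 2 → ℝ)) (T : ℝ) (hT : ∀ τ ∈ tieTimes σ P, -T ≤ τ) :
    (P.filter fun p => ∃ t ∈ Set.Iio (-T), IsStrictTop ![σ, t] P p).card ≤ 1 := by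
  classical
  refine (card_chartTops_le_card_ties_add_one σ P (Set.Iio (-T)) Set.ordConnected_Iio).trans ?_
  exact Nat.add_le_add_right (Nat.le_zero.2 (Finset.card_eq_zero.2 (Finset.filter_eq_empty_iff.2
    fun τ hτ hτI => absurd (hT τ hτ) (not_le.2 hτI)))) 1

/-! ### The per-chart bound -/

open Classical in
/-- **Separated regime, one half-chart.**  For `σ = ±1`, curves `a, b` and an injective third curve `c` there is `μ₀` with
`∑_s #tops_σ(class s of (a, b, μ • c)) ≤ ∑_r #tops_σ(P_r) + 7|G|²` for all `μ ≥ μ₀`. [folklore] -/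
theorem sum_card_chartTops_smul_le {σ : ℝ} (hσ : σ = 1 ∨ σ = -1) (a b c : G → (Fin 2 → ℝ))
    (hc : Function.Injective c) :
    ∃ μ₀ : ℝ, ∀ μ : ℝ, μ₀ ≤ μ →
      ∑ s, ((Finset.univ.image fun p : G × G => a p.1 + b p.2 + (μ • c) (s - p.1 - p.2)).filter fun v =>
          ∃ t, IsStrictTop ![σ, t] (Finset.univ.image fun p : G × G => a p.1 + b p.2 + (μ • c) (s - p.1 - p.2)) v).card ≤
        ∑ r, ((Finset.univ.image fun x : G => a x + b (r - x)).filter fun p =>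
          ∃ t, IsStrictTop ![σ, t] (Finset.univ.image fun x : G => a x + b (r - x)) p).card +
        7 * Fintype.card G ^ 2 := by
  classical
  have hσ0 : σ ≠ 0 := by rcases hσ with h | h <;> simp [h]
  have hw0 : ∀ t : ℝ, |(![σ, t] : Fin 2 → ℝ) 0| + |(![σ, t] : Fin 2 → ℝ) 1| = 1 + |t| := fun t => by rcases hσ with h | h <;> simp [h]
  -- the point sets
  set CF : Finset (Fin 2 → ℝ) := Finset.univ.image c with hCF
  set P : G → Finset (Fin 2 → ℝ) := fun r => Finset.univ.image fun x : G => a x + b (r - x) with hP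
  have hCFne : CF.Nonempty := ⟨c 0, Finset.mem_image.2 ⟨0, Finset.mem_univ _, rfl⟩⟩
  have hmemCF : ∀ z, c z ∈ CF := fun z => Finset.mem_image.2 ⟨z, Finset.mem_univ _, rfl⟩
  -- the constants of the curves (kept opaque)
  obtain ⟨Λ, hΛdef⟩ : ∃ Λ : ℝ, Λ = 2 * ∑ u, (|c u 0| + |c u 1|) := ⟨_, rfl⟩
  have hΛ0 : 0 ≤ Λ := by rw [hΛdef]; positivity
  have hΛ : ∀ z z' (i : Fin 2), |c z i - c z' i| ≤ Λ := fun z z' i => by rw [hΛdef]; exact abs_coord_sub_le c z z' i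
  obtain ⟨R, hRdef⟩ : ∃ R : ℝ, R = 4 * (∑ u, (|a u 0| + |a u 1|) + ∑ u, (|b u 0| + |b u 1|)) := ⟨_, rfl⟩
  have hR0 : 0 ≤ R := by rw [hRdef]; positivity
  have hβ : ∀ t : ℝ, bandWidth ![σ, t] a b ≤ (1 + |t|) * R := fun t => by
    have := bandWidth_le ![σ, t] a b; rwa [hw0 t, ← hRdef] at this
  -- tie times and separation constants
  set TC := tieTimes σ CF with hTC
  set Tall := TC ∪ Finset.univ.biUnion fun r => tieTimes σ (P r) with hTall
  obtain ⟨γ, hγ0, hγ⟩ := exists_gap Tall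
  obtain ⟨κ₀, hκ₀0, hκ₀⟩ := exists_gap (Finset.univ.image fun z => c z 0)
  obtain ⟨κ₁, hκ₁0, hκ₁⟩ := exists_gap (Finset.univ.image fun z => c z 1)
  obtain ⟨g, hg0, hg⟩ := exists_gap (TC.biUnion fun u => Finset.univ.image fun z => ![σ, u] ⬝ᵥ c z)
  -- window radius `ε`, horizon `T`, far margin `κ`
  obtain ⟨ε, hεdef⟩ : ∃ ε : ℝ, ε = min (γ / 2) (g / (2 * Λ + 2)) := ⟨_, rfl⟩
  have hε0 : 0 < ε := by rw [hεdef]; exact lt_min (by linarith) (div_pos hg0 (by linarith))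
  have hεγ : 2 * ε ≤ γ := by linarith [show ε ≤ γ / 2 by rw [hεdef]; exact min_le_left _ _]
  have hεΛ : ε * Λ ≤ g / 2 := by
    have h1 : ε ≤ g / (2 * Λ + 2) := by rw [hεdef]; exact min_le_right _ _
    have h := (le_div_iff₀ (by linarith : (0 : ℝ) < 2 * Λ + 2)).1 h1
    linarith [show ε * (2 * Λ + 2) = 2 * (ε * Λ) + 2 * ε by ring]
  obtain ⟨MT, hMTdef⟩ : ∃ MT : ℝ, MT = ∑ τ ∈ Tall, |τ| := ⟨_, rfl⟩
  have hMT : ∀ τ ∈ Tall, |τ| ≤ MT := fun τ hτ => by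
    rw [hMTdef]; exact Finset.single_le_sum (f := fun τ => |τ|) (fun τ _ => abs_nonneg τ) hτ
  have hMT0 : 0 ≤ MT := by rw [hMTdef]; exact Finset.sum_nonneg fun τ _ => abs_nonneg τ
  obtain ⟨T, hTdef⟩ : ∃ T : ℝ, T = 1 + MT + 2 * Λ / κ₁ := ⟨_, rfl⟩
  have hT2 : 0 ≤ 2 * Λ / κ₁ := div_nonneg (by linarith) hκ₁0.le
  have hT1 : 1 ≤ T := by rw [hTdef]; linarith
  have hTend : 1 + 2 * Λ / κ₁ ≤ T := by rw [hTdef]; linarith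
  have hTtie : ∀ τ ∈ Tall, |τ| + 1 ≤ T := fun τ hτ => by rw [hTdef]; linarith [hMT τ hτ]
  have hPtie : ∀ r, ∀ τ ∈ tieTimes σ (P r), τ ∈ Tall := fun r τ hτ =>
    Finset.mem_union_right _ (Finset.mem_biUnion.2 ⟨r, Finset.mem_univ _, hτ⟩)
  obtain ⟨κ, hκdef⟩ : ∃ κ : ℝ, κ = min κ₀ (ε * κ₁) := ⟨_, rfl⟩
  have hκ0 : 0 < κ := by rw [hκdef]; exact lt_min hκ₀0 (mul_pos hε0 hκ₁0)
  -- the threshold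
  refine ⟨(1 + T) * R / κ + 2 * ((1 + T) * R) / g + 4 * R / κ₁ + 1, fun μ hμ => ?_⟩
  have hTR : 0 ≤ (1 + T) * R := by positivity
  have hs1 : 0 ≤ (1 + T) * R / κ := div_nonneg hTR hκ0.le
  have hs2 : 0 ≤ 2 * ((1 + T) * R) / g := div_nonneg (by positivity) hg0.le
  have hs3 : 0 ≤ 4 * R / κ₁ := div_nonneg (by positivity) hκ₁0.le
  have hμ0 : 0 < μ := by linarith
  have hμκ : (1 + T) * R < μ * κ := (div_lt_iff₀ hκ0).1 (by linarith)
  have hμg : (1 + T) * R < μ * (g / 2) := by linarith [(div_lt_iff₀ hg0).1 (by linarith : 2 * ((1 + T) * R) / g < μ)]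
  have hμe : 2 * R < μ * κ₁ / 2 := by linarith [(div_lt_iff₀ hκ₁0).1 (by linarith : 4 * R / κ₁ < μ)]
  have hinj : Function.Injective (μ • c) := fun z z' h => by
    rw [Pi.smul_apply, Pi.smul_apply] at h; exact hc (smul_right_injective (Fin 2 → ℝ) hμ0.ne' h)
  -- the winning-position inequality of an exposed word
  have hqual : ∀ (s : G) (t : ℝ) (x r z : G), r + z = s →
      IsStrictTop ![σ, t] (Finset.univ.image fun p : G × G => a p.1 + b p.2 + (μ • c) (s - p.1 - p.2))
        (a x + b (r - x) + (μ • c) z) →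
      ∀ z', μ * (![σ, t] ⬝ᵥ c z' - ![σ, t] ⬝ᵥ c z) ≤ (1 + |t|) * R :=
    fun s t x r z hs htop z' => (qual_of_isStrictTop a b c μ _ s r z x hs htop z').trans (hβ t)
  -- localisation data
  set Zmax : ℝ → Finset G := fun u => Finset.univ.filter fun z : G => ∀ z' : G, ![σ, u] ⬝ᵥ c z' ≤ ![σ, u] ⬝ᵥ c z
    with hZmax
  set E : Finset ℝ := TC.filter fun u => 2 ≤ (Zmax u).card with hEdef
  set Zp : Finset G := Finset.univ.filter fun z : G => ∀ z' : G, c z' 1 ≤ c z 1 with hZp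
  set Zm : Finset G := Finset.univ.filter fun z : G => ∀ z' : G, c z 1 ≤ c z' 1 with hZm
  set W : ℝ ⊕ Bool → Set ℝ :=
    Sum.elim (fun u => Set.Ioo (u - ε) (u + ε)) (fun bb => cond bb (Set.Ioi T) (Set.Iio (-T))) with hW
  set Z : ℝ ⊕ Bool → Finset G := Sum.elim Zmax (fun bb => cond bb Zp Zm) with hZ
  set n : ℝ ⊕ Bool → ℕ := Sum.elim (fun _ => 2) (fun _ => 1) with hn
  set KS : Finset (ℝ ⊕ Bool) := E.image Sum.inl ∪ {Sum.inr true, Sum.inr false} with hKS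
  set Y : G → Set ℝ := fun z => {t | IsStrictTop ![σ, t] CF (c z)} with hY
  -- (1) cores consist of strict-top times (for the scaled curve)
  have hYtop : ∀ z, ∀ t ∈ Y z, IsStrictTop ![σ, t] (Finset.univ.image (μ • c)) ((μ • c) z) :=
    fun z t ht => isStrictTop_image_smul hμ0 ht
  -- (2) the windows see few fibre tops
  have hwin : ∀ k ∈ KS, ∀ r : G, ((P r).filter fun p => ∃ t ∈ W k, IsStrictTop ![σ, t] (P r) p).card ≤ n k := by
    intro k hk r
    rcases Finset.mem_union.1 hk with hk | hk
    · obtain ⟨u, -, rfl⟩ := Finset.mem_image.1 hk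
      exact card_chartTops_window_le_two σ (P r) u ε γ
        (fun τ hτ τ' hτ' hne => hγ τ (hPtie r τ hτ) τ' (hPtie r τ' hτ') hne) hεγ
    · rcases Finset.mem_insert.1 hk with rfl | hk
      · exact card_chartTops_Ioi_le_one σ (P r) T fun τ hτ => by linarith [hTtie τ (hPtie r τ hτ), le_abs_self τ]
      · rw [Finset.mem_singleton] at hk; subst hk
        exact card_chartTops_Iio_le_one σ (P r) T fun τ hτ => by linarith [hTtie τ (hPtie r τ hτ), neg_abs_le τ]
  -- (3) the cover
  have hcov : ∀ (s : G) (t : ℝ) (x r z : G), r + z = s →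
      IsStrictTop ![σ, t] (Finset.univ.image fun p : G × G => a p.1 + b p.2 + (μ • c) (s - p.1 - p.2))
        (a x + b (r - x) + (μ • c) z) →
      t ∈ Y z ∨ ∃ k ∈ KS, t ∈ W k ∧ z ∈ Z k := by
    intro s t x r z hs htop
    have hq := hqual s t x r z hs htop
    by_cases hpos : T < t
    · -- right end window
      refine Or.inr ⟨Sum.inr true, Finset.mem_union_right _ (by simp), ?_, ?_⟩
      · exact show t ∈ Set.Ioi T from hpos
      · refine show z ∈ Zp from Finset.mem_filter.2 ⟨Finset.mem_univ _, ?_⟩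
        by_contra hnot; push Not at hnot; obtain ⟨z₁, hz₁⟩ := hnot
        obtain ⟨zp, -, hzp⟩ := Finset.exists_max_image Finset.univ (fun z : G => c z 1) univ_nonempty_group
        have hlt : c z 1 < c zp 1 := hz₁.trans_le (hzp z₁ (Finset.mem_univ _))
        have ht0 : 0 < t := by linarith
        have hm := end_margin_top (σ := σ) hσ (F := CF) (xp := c zp) (κ₁ := κ₁) (Λ := Λ) (T := T) (t := t) hκ₁0
          (fun y hy hy1 => by
            obtain ⟨z'', -, rfl⟩ := Finset.mem_image.1 hy
            have h := hκ₁ (c zp 1) (Finset.mem_image.2 ⟨zp, Finset.mem_univ _, rfl⟩) (c z'' 1)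
              (Finset.mem_image.2 ⟨z'', Finset.mem_univ _, rfl⟩) (ne_of_gt hy1)
            rwa [abs_of_pos (sub_pos.2 hy1)] at h)
          (fun y hy => by obtain ⟨z'', -, rfl⟩ := Finset.mem_image.1 hy; exact hΛ zp z'' 0)
          hTend hpos (hmemCF z) hlt
        have h1 := hq zp; rw [abs_of_pos ht0] at h1
        have h2 : μ * (t * κ₁ / 2) ≤ (1 + t) * R := (mul_le_mul_of_nonneg_left hm hμ0.le).trans h1
        have h3 : (1 + t) * R ≤ (2 * t) * R := mul_le_mul_of_nonneg_right (by linarith) hR0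
        have h4 : t * (2 * R) < t * (μ * κ₁ / 2) := mul_lt_mul_of_pos_left hμe ht0
        linarith [show μ * (t * κ₁ / 2) = t * (μ * κ₁ / 2) by ring, show (2 * t) * R = t * (2 * R) by ring]
    by_cases hneg : t < -T
    · -- left end window
      refine Or.inr ⟨Sum.inr false, Finset.mem_union_right _ (by simp), ?_, ?_⟩
      · exact show t ∈ Set.Iio (-T) from hneg
      · refine show z ∈ Zm from Finset.mem_filter.2 ⟨Finset.mem_univ _, ?_⟩
        by_contra hnot; push Not at hnot; obtain ⟨z₁, hz₁⟩ := hnot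
        obtain ⟨zm, -, hzm⟩ := Finset.exists_min_image Finset.univ (fun z : G => c z 1) univ_nonempty_group
        have hlt : c zm 1 < c z 1 := (hzm z₁ (Finset.mem_univ _)).trans_lt hz₁
        have ht0 : 0 < -t := by linarith
        have hm := end_margin_bot (σ := σ) hσ (F := CF) (xm := c zm) (κ₁ := κ₁) (Λ := Λ) (T := T) (t := t) hκ₁0
          (fun y hy hy1 => by
            obtain ⟨z'', -, rfl⟩ := Finset.mem_image.1 hy
            have h := hκ₁ (c z'' 1) (Finset.mem_image.2 ⟨z'', Finset.mem_univ _, rfl⟩) (c zm 1)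
              (Finset.mem_image.2 ⟨zm, Finset.mem_univ _, rfl⟩) (ne_of_gt hy1)
            rwa [abs_of_pos (sub_pos.2 hy1)] at h)
          (fun y hy => by obtain ⟨z'', -, rfl⟩ := Finset.mem_image.1 hy; exact hΛ zm z'' 0)
          hTend hneg (hmemCF z) hlt
        have h1 := hq zm; rw [abs_of_neg (by linarith : t < 0)] at h1
        have h2 : μ * (-t * κ₁ / 2) ≤ (1 + -t) * R := (mul_le_mul_of_nonneg_left hm hμ0.le).trans h1
        have h3 : (1 + -t) * R ≤ (2 * -t) * R := mul_le_mul_of_nonneg_right (by linarith) hR0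
        have h4 : -t * (2 * R) < -t * (μ * κ₁ / 2) := mul_lt_mul_of_pos_left hμe ht0
        linarith [show μ * (-t * κ₁ / 2) = -t * (μ * κ₁ / 2) by ring, show (2 * -t) * R = -t * (2 * R) by ring]
    -- bounded times: `|t| ≤ T`
    push Not at hpos hneg
    have htabs : |t| ≤ T := abs_le.2 ⟨by linarith, hpos⟩
    have hbound : ∀ z', μ * (![σ, t] ⬝ᵥ c z' - ![σ, t] ⬝ᵥ c z) ≤ (1 + T) * R := fun z' =>
      (hq z').trans (mul_le_mul_of_nonneg_right (by linarith) hR0)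
    by_cases hnear : ∃ u ∈ TC, |t - u| < ε
    · obtain ⟨u, hu, htu⟩ := hnear
      -- gap at `u` and spread, for `near_margin`
      have hgap : ∀ z₁ : G, ∀ y ∈ CF, ![σ, u] ⬝ᵥ y < ![σ, u] ⬝ᵥ c z₁ →
          g ≤ ![σ, u] ⬝ᵥ c z₁ - ![σ, u] ⬝ᵥ y := by
        intro z₁ y hy hlt
        obtain ⟨z'', -, rfl⟩ := Finset.mem_image.1 hy
        have h := hg (![σ, u] ⬝ᵥ c z₁)
          (Finset.mem_biUnion.2 ⟨u, hu, Finset.mem_image.2 ⟨z₁, Finset.mem_univ _, rfl⟩⟩)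
          (![σ, u] ⬝ᵥ c z'')
          (Finset.mem_biUnion.2 ⟨u, hu, Finset.mem_image.2 ⟨z'', Finset.mem_univ _, rfl⟩⟩) (ne_of_gt hlt)
        rwa [abs_of_pos (sub_pos.2 hlt)] at h
      have hspread : ∀ z₁ : G, ∀ y ∈ CF, |c z₁ 1 - y 1| ≤ Λ := by
        intro z₁ y hy
        obtain ⟨z'', -, rfl⟩ := Finset.mem_image.1 hy
        exact hΛ z₁ z'' 1
      -- `z` is a maximiser at `u`
      have hzmax : ∀ z' : G, ![σ, u] ⬝ᵥ c z' ≤ ![σ, u] ⬝ᵥ c z := by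
        by_contra hnot; push Not at hnot; obtain ⟨z', hz'⟩ := hnot
        obtain ⟨z₁, -, hz₁⟩ := Finset.exists_max_image Finset.univ (fun z : G => ![σ, u] ⬝ᵥ c z)
          univ_nonempty_group
        have hlt : ![σ, u] ⬝ᵥ c z < ![σ, u] ⬝ᵥ c z₁ := hz'.trans_le (hz₁ z' (Finset.mem_univ _))
        have hm := near_margin (hgap z₁) (hspread z₁) hεΛ htu.le (hmemCF z) hlt
        have h2 : μ * (g / 2) ≤ (1 + T) * R := (mul_le_mul_of_nonneg_left hm hμ0.le).trans (hbound z₁)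
        linarith
      by_cases hE2 : 2 ≤ (Zmax u).card
      · -- a genuine window
        refine Or.inr ⟨Sum.inl u,
          Finset.mem_union_left _ (Finset.mem_image.2 ⟨u, Finset.mem_filter.2 ⟨hu, hE2⟩, rfl⟩), ?_, ?_⟩
        · show t ∈ Set.Ioo (u - ε) (u + ε)
          rw [abs_sub_lt_iff] at htu
          exact ⟨by linarith [htu.1, htu.2], by linarith [htu.1, htu.2]⟩
        · show z ∈ Zmax u
          exact Finset.mem_filter.2 ⟨Finset.mem_univ _, hzmax⟩
      · -- a unique maximiser: `c z` stays the strict top near `u`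
        push Not at hE2
        have hzmem : z ∈ Zmax u := Finset.mem_filter.2 ⟨Finset.mem_univ _, hzmax⟩
        have huniqG : ∀ z' ∈ Zmax u, z' = z := fun z' hz' =>
          Finset.card_le_one.1 (by omega) z' hz' z hzmem
        have huniq : ∀ y ∈ CF, y ≠ c z → ![σ, u] ⬝ᵥ y < ![σ, u] ⬝ᵥ c z := by
          intro y hy hne
          obtain ⟨z', -, rfl⟩ := Finset.mem_image.1 hy
          refine lt_of_le_of_ne (hzmax z') fun heq => hne ?_
          have hz'mem : z' ∈ Zmax u :=
            Finset.mem_filter.2 ⟨Finset.mem_univ _, fun z'' => by rw [heq]; exact hzmax z''⟩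
          rw [huniqG z' hz'mem]
        exact Or.inl (isStrictTop_near (hmemCF z) huniq (hgap z) hg0 (hspread z) hεΛ htu.le)
    · -- far from every tie time of `C`
      push Not at hnear
      obtain ⟨xh, hxh, htopF, hmargin⟩ := far_margin hσ CF hCFne hε0
        (fun x hx y hy h1 h0 => by
          obtain ⟨z₁, -, rfl⟩ := Finset.mem_image.1 hx
          obtain ⟨z₂, -, rfl⟩ := Finset.mem_image.1 hy
          exact hκ₀ (c z₁ 0) (Finset.mem_image.2 ⟨z₁, Finset.mem_univ _, rfl⟩) (c z₂ 0)
            (Finset.mem_image.2 ⟨z₂, Finset.mem_univ _, rfl⟩) h0)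
        (fun x hx y hy h1 => by
          obtain ⟨z₁, -, rfl⟩ := Finset.mem_image.1 hx
          obtain ⟨z₂, -, rfl⟩ := Finset.mem_image.1 hy
          exact hκ₁ (c z₁ 1) (Finset.mem_image.2 ⟨z₁, Finset.mem_univ _, rfl⟩) (c z₂ 1)
            (Finset.mem_image.2 ⟨z₂, Finset.mem_univ _, rfl⟩) h1)
        hnear
      obtain ⟨zh, -, rfl⟩ := Finset.mem_image.1 hxh
      by_cases hzz : c z = c zh
      · exact Or.inl (show IsStrictTop ![σ, t] CF (c z) by rw [hzz]; exact htopF)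
      · have hm := hmargin (c z) (hmemCF z) hzz
        rw [← hκdef] at hm
        have h2 : μ * κ ≤ (1 + T) * R := (mul_le_mul_of_nonneg_left hm hμ0.le).trans (hbound zh)
        linarith
  -- (4) the abstract sweep
  have main := sum_card_chartTops_class_le a b (μ • c) hinj σ Y KS W Z n hYtop hcov hwin
  -- (5) the window budget: `∑_k #Z_k · n_k ≤ 6|G|`
  have hbudget : ∑ k ∈ KS, (Z k).card * n k ≤ 6 * Fintype.card G := by
    have hdisj : Disjoint (E.image Sum.inl) ({Sum.inr true, Sum.inr false} : Finset (ℝ ⊕ Bool)) := by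
      rw [Finset.disjoint_left]; intro k hk hk'
      obtain ⟨u, -, rfl⟩ := Finset.mem_image.1 hk; simp at hk'
    rw [hKS, Finset.sum_union hdisj, Finset.sum_image fun u _ u' _ h => Sum.inl_injective h,
      Finset.sum_pair (by simp)]
    simp only [hZ, hn, Sum.elim_inl, Sum.elim_inr, cond_true, cond_false, mul_one]
    have hE : ∑ u ∈ E, (Zmax u).card ≤ 2 * Fintype.card G :=
      sum_card_maxSet_le hσ0 c hc E fun u hu => (Finset.mem_filter.1 hu).2
    have hE' : ∑ u ∈ E, (Zmax u).card * 2 ≤ 4 * Fintype.card G := by rw [← Finset.sum_mul]; omega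
    have hp : Zp.card ≤ Fintype.card G := (Finset.card_filter_le _ _).trans (by rw [Finset.card_univ])
    have hm : Zm.card ≤ Fintype.card G := (Finset.card_filter_le _ _).trans (by rw [Finset.card_univ])
    omega
  have h7 : Fintype.card G * Fintype.card G + Fintype.card G * ∑ k ∈ KS, (Z k).card * n k ≤
      7 * Fintype.card G ^ 2 := by
    have h1 := Nat.mul_le_mul_left (Fintype.card G) hbudget
    have e : Fintype.card G * (6 * Fintype.card G) = 6 * (Fintype.card G * Fintype.card G) := by ring
    rw [sq]
    omega
  exact main.trans (by rw [add_assoc]; exact Nat.add_le_add_left h7 _)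

/-! ### The regime theorem -/

/-- **The large-third-curve (separated) regime of the `n = 3` totals law** (memo NOTES-d1g3 §2 L5 second regime; NOTES-t1 §5(i)):
for curves `a, b` and an INJECTIVE third curve `c` there is `μ₀` such that for every `μ ≥ μ₀`
`T(a, b, μ • c) ≤ V_P + 2|G| + 14|G|²` (`V_P = fibreTotal a b = ∑_r V(P_r)`). [folklore] -/
theorem totalVert_smul_le_of_large (a b c : G → (Fin 2 → ℝ)) (hc : Function.Injective c) :
    ∃ μ₀ : ℝ, ∀ μ : ℝ, μ₀ ≤ μ →
      totalVert a b (μ • c) ≤ fibreTotal a b + 2 * Fintype.card G + 14 * Fintype.card G ^ 2 := by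
  classical
  obtain ⟨μ₁, h₁⟩ := sum_card_chartTops_smul_le (σ := 1) (Or.inl rfl) a b c hc
  obtain ⟨μ₂, h₂⟩ := sum_card_chartTops_smul_le (σ := -1) (Or.inr rfl) a b c hc
  refine ⟨max μ₁ μ₂, fun μ hμ => ?_⟩
  have e := totalVert_le_of_chart_bounds a b (μ • c) (7 * Fintype.card G ^ 2) (7 * Fintype.card G ^ 2)
    (h₁ μ ((le_max_left _ _).trans hμ)) (h₂ μ ((le_max_right _ _).trans hμ))
  omega

/-- **`T(a, b, μ • c) ≤ 17 |G|²` for `μ ≥ μ₀`**: the weak totals law with the explicit constant `17` holds on the separated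
stratum (crude; the memo's value at this end is `V_P + q·vert(C) ≤ 2q²`). [folklore] -/
theorem totalVert_smul_le_seventeen_mul_sq (a b c : G → (Fin 2 → ℝ)) (hc : Function.Injective c) :
    ∃ μ₀ : ℝ, ∀ μ : ℝ, μ₀ ≤ μ → totalVert a b (μ • c) ≤ 17 * Fintype.card G ^ 2 := by
  obtain ⟨μ₀, h⟩ := totalVert_smul_le_of_large a b c hc
  refine ⟨μ₀, fun μ hμ => (h μ hμ).trans ?_⟩
  have h1 : fibreTotal a b ≤ Fintype.card G ^ 2 := fibreTotal_le_card_sq a b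
  have h2 : Fintype.card G ≤ Fintype.card G ^ 2 := card_le_card_sq
  omega

end TotalsLaw

end Summit.ValiantsHypothesis.ValiantsHypothesis.Theorems.NewtonUnitEquationsDissociatedUniform
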